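import HarnessLib
import Summits.Langlands.Langlands.Theses.AbelianSurfaceSerre
import Summits.Langlands.Langlands.Theorems.BianchiCongruenceCohomologyFinite.Negative.FalseWithoutFinite

/-!
# `QuadraticImprimitiveSurfaces` (stmt-Langlands-17766, crux K2 of route `AbelianSurfaceSerre`) —
# Negative knowledge: hypothesis anatomy

Refuter cdisprove cycle 1 (2026-08-17). K2 = "every abelian surface `A/ℚ` with `End_ℚ(A) = ℤ` whose
dual Tate representation `r` becomes reducible over some quadratic field is modular (a.e. Satake form,
L-normalisation)". No `¬`-theorem of K2 is expected (it is the Target `EndTrivialSurfacesModular`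
restricted to a sub-class, believed true: BCGP 2025 Rem. 10.2.2 "remains open", FLS 2015 /
Caraiani–Newton slices are theorems). These sorry-free lemmas fence the statement for its provers
and for the planner's repair logic:

* `not_endTrivialSurfacesModular_of_not` — K2 is a restriction of the Target, so a refutation of K2
  IS a refutation of the Target (route kill criteria (a) and (c) coincide over `ℚ`).
* `dim_eq_two_of_basis`, `quadraticImprimitiveSurfaces_without_dim` — the hypothesis `A.dim = 2`
  is NOT load-bearing: it follows from the binder `b : Basis (Fin 4) ℚ_p (V_p A)` modulo the
  vendored rank fact `AbelianVariety.finrank_rationalTateModule_eq` (Mumford §19 p. 172), taken as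
  an explicit hypothesis (D-0014).
* `not_isIrreducible_one`, `imprimitivity_clause_one` — the distinguishing hypothesis
  "`r|_{Γ_K}` reducible for some quadratic `K`" has no force in isolation: the TRIVIAL rank-4
  representation meets it (`K = ℚ(ζ₃)`, `[ℚ(ζ₃):ℚ] = 2` reused from
  `BianchiCongruenceCohomologyFinite.Negative.finrank_cyclotomicField_three`). All the strength of K2 sits in the framing of `r` by an
  abelian surface with `End_ℚ(A) = ℤ` (Faltings ⇒ `r` irreducible over `ℚ`; Clifford ⇒
  `r ≃ Ind_K^ℚ s`), which any proof must route through.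

No proposition is defined under `Summits/`; no statement of the route is asserted. [folklore]
-/

set_option linter.dupNamespace false -- project-wide option; `Summit.Langlands.Langlands` is the mandated namespace

noncomputable section

open Summit.Langlands.Langlands.Theses.AbelianSurfaceSerre
open Literature.NumberTheory.GaloisRepresentations Literature.NumberTheory.Automorphic
open Literature.AlgebraicGeometry.Motives
open IsDedekindDomain NumberField Field

namespace Summit.Langlands.Langlands.Theorems.QuadraticImprimitiveSurfaces.Negative

/-! ### K2 is a restriction of the Target -/

/-- **A refutation of K2 refutes the Target.** `QuadraticImprimitiveSurfaces` is
`EndTrivialSurfacesModular` with one extra hypothesis, so `¬ K2 → ¬ Target` (contrapositive of the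
one-line restriction). For the planner: kill criterion (c) of the route (a non-automorphic
`GL₂`-type surface over a quadratic field, descended to `ℚ`) is kill criterion (a) (a non-modular
abelian surface over `ℚ` with `End_ℚ = ℤ`). [folklore] -/
theorem not_endTrivialSurfacesModular_of_not (h : ¬ QuadraticImprimitiveSurfaces) :
    ¬ EndTrivialSurfacesModular :=
  fun ht => h fun A hd hE p _ b r hr _ => ht A hd hE p b r hr

/-! ### `A.dim = 2` is not load-bearing -/

/-- `dim A = 2` follows from a basis of `V_p A` indexed by `Fin 4`, modulo the vendored rank fact
`dim_{ℚ_p} V_p A = 2 · dim A` (Mumford, *Abelian Varieties*, §19 p. 172), an explicit hypothesis.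
[folklore] -/
theorem dim_eq_two_of_basis (p : ℕ) [Fact p.Prime] (A : AbelianVariety ℚ)
    (hrk : A.finrank_rationalTateModule_eq p)
    (b : Module.Basis (Fin 4) ℚ_[p] (A.rationalTateModule p)) : A.dim = 2 := by
  have hp : ((p : ℕ) : ℚ) ≠ 0 := by exact_mod_cast (Fact.out : p.Prime).ne_zero
  have h1 := hrk hp
  have h2 : Module.finrank ℚ_[p] (A.rationalTateModule p) = 4 := by
    simpa using Module.finrank_eq_card_basis b
  omega

/-- **`A.dim = 2` is not load-bearing in K2**: modulo the rank fact, K2 implies its own variant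
with the hypothesis `A.dim = 2` deleted (everything else verbatim). So provers may treat the
dimension hypothesis as bookkeeping; the content is in `End_ℚ(A) = ℤ` and the framing. [folklore] -/
theorem quadraticImprimitiveSurfaces_without_dim
    (hrk : ∀ (A : AbelianVariety ℚ) (p : ℕ) [Fact p.Prime], A.finrank_rationalTateModule_eq p)
    (h : QuadraticImprimitiveSurfaces) :
    ∀ (A : AbelianVariety ℚ),
      (∀ f : A ⟶ A, ∃ n : ℤ, f = n • CategoryTheory.CategoryStruct.id A) →
      ∀ (p : ℕ) [Fact p.Prime] (b : Module.Basis (Fin 4) ℚ_[p] (A.rationalTateModule p))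
        (r : FramedGaloisRep ℚ (PadicAlgCl p) 4),
        (∀ g : absoluteGaloisGroup ℚ, (r g).val =
          ((LinearMap.toMatrix b b (A.rationalTateRep p g⁻¹)).map
            (algebraMap ℚ_[p] (PadicAlgCl p))).transpose) →
        (∃ (K : Type) (_ : Field K) (_ : NumberField K), Module.finrank ℚ K = 2 ∧
          ¬ FramedRep.IsIrreducible (r.restrictField K)) →
        ∀ (hcpt : isCompact_glFiniteIntegralLevel 4 ℚ) (ι : PadicAlgCl p ≃+* ℂ),
          ∃ π : CuspidalAutomorphicRepData 4 ℚ hcpt, π.1.IsLAlgebraic ∧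
            ∀ᶠ v : HeightOneSpectrum (𝓞 ℚ) in Filter.cofinite, ∃ a : Multiset ℂ,
              π.1.HasSatakeParamAt v a ∧ r.IsUnramifiedAt v ∧
                r.HasFrobCharpolyAt v (arithFrobPolyOfSatake ι v.residueCard 1 a) :=
  fun A hE p _ b r hr hK => h A (dim_eq_two_of_basis p A (hrk A p) b) hE p b r hr hK

/-! ### The imprimitivity hypothesis has no force in isolation -/

/-- The trivial rank-4 framed representation of any topological group over `ℚ̄_p` is reducible:
the line `ℚ̄_p · e₀` is a proper non-zero subrepresentation (Mathlib `Representation.IsIrreducible`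
= `IsSimpleOrder (Subrepresentation _)`). [folklore] -/
theorem not_isIrreducible_one (p : ℕ) [Fact p.Prime] {G : Type*} [Group G] [TopologicalSpace G] :
    ¬ FramedRep.IsIrreducible (1 : FramedRep G (PadicAlgCl p) 4) := by
  intro hirr
  have hρg : ∀ (g : G) (v : Fin 4 → PadicAlgCl p),
      FramedRep.toRepresentation (1 : FramedRep G (PadicAlgCl p) 4) g v = v := by
    intro g v
    rw [FramedRep.toRepresentation_apply_apply]
    simp
  let e₀ : Fin 4 → PadicAlgCl p := Pi.single 0 1
  let e₁ : Fin 4 → PadicAlgCl p := Pi.single 1 1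
  let σ₀ : Subrepresentation (FramedRep.toRepresentation (1 : FramedRep G (PadicAlgCl p) 4)) :=
    ⟨Submodule.span (PadicAlgCl p) {e₀}, fun g v hv => by rw [hρg]; exact hv⟩
  haveI := hirr
  rcases IsSimpleOrder.eq_bot_or_eq_top σ₀ with h | h
  · have hmem : e₀ ∈ σ₀.toSubmodule := Submodule.subset_span rfl
    have hbot : σ₀.toSubmodule = ⊥ := by
      have := congrArg Subrepresentation.toSubmodule h
      exact this
    rw [hbot, Submodule.mem_bot] at hmem
    have h0 := congrFun hmem 0
    simp [e₀] at h0
  · have htop : σ₀.toSubmodule = ⊤ := by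
      have := congrArg Subrepresentation.toSubmodule h
      exact this
    have hmem : e₁ ∈ σ₀.toSubmodule := by rw [htop]; exact Submodule.mem_top
    obtain ⟨c, hc⟩ := Submodule.mem_span_singleton.mp hmem
    have h1 := congrFun hc 1
    simp [e₀, e₁] at h1

/-- **The imprimitivity clause of K2 is met by the trivial representation** (`K = ℚ(ζ₃)`; the
restriction of `1` along `absGaloisRestrict` is `1`). Hence the clause
`∃ K quadratic, ¬ IsIrreducible (r|_K)` distinguishes K2 from the Target only THROUGH the other
hypotheses (abelian-surface framing + `End_ℚ(A) = ℤ`): dropped from an abelian surface, the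
representation-level statement "quadratically imprimitive ⇒ cuspidal automorphic on `GL₄`" has the
trivial representation as an instance of its hypothesis (and is false in nature by Jacquet–Shalika,
*Amer. J. Math.* 103 (1981) Thm. 4.4 — not formalised here). [folklore] -/
theorem imprimitivity_clause_one (p : ℕ) [Fact p.Prime] :
    ∃ (K : Type) (_ : Field K) (_ : NumberField K), Module.finrank ℚ K = 2 ∧
      ¬ FramedRep.IsIrreducible
        ((1 : FramedGaloisRep ℚ (PadicAlgCl p) 4).restrictField K) := by
  refine ⟨CyclotomicField 3 ℚ, inferInstance, inferInstance,
    BianchiCongruenceCohomologyFinite.Negative.finrank_cyclotomicField_three, ?_⟩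
  have : (1 : FramedGaloisRep ℚ (PadicAlgCl p) 4).restrictField (CyclotomicField 3 ℚ) =
      (1 : FramedGaloisRep (CyclotomicField 3 ℚ) (PadicAlgCl p) 4) :=
    ContinuousMonoidHom.ext fun _ => rfl
  rw [this]
  exact not_isIrreducible_one p

end Summit.Langlands.Langlands.Theorems.QuadraticImprimitiveSurfaces.Negative

end
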